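import Summits.AnomalousDissipation.AnomalousDissipation.Theses.MomentParity
import Summits.AnomalousDissipation.AnomalousDissipation.Theorems.MomentParityGalerkinEnsembleRealization
import Summits.AnomalousDissipation.AnomalousDissipation.Theorems.ResolvedDissipation.Negative.KillShape
import Summits.AnomalousDissipation.AnomalousDissipation.Theorems.MomentParityResolvedDissipationInvariance
import Summits.AnomalousDissipation.AnomalousDissipation.Theorems.MomentParityResolvedDissipationStubLeakingSequence
import Summits.AnomalousDissipation.AnomalousDissipation.Theorems.MomentParityResolvedDissipationStubLevelWorkMean
import Summits.AnomalousDissipation.AnomalousDissipation.Theorems.MomentParityResolvedDissipationStubLimitLawDefect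
import Summits.AnomalousDissipation.AnomalousDissipation.Theorems.MomentParityResolvedDissipationStubSupportPointDefect
import Summits.AnomalousDissipation.AnomalousDissipation.Theorems.MomentParityResolvedDissipationStubRealisedStrictInequality
import Literature.Analysis.FluidPDE.NSEnergyClassEnergyEquality
import Literature.Analysis.FluidPDE.PlanarDescentEnergyEq

/-!
# The Leray–Hopf energy-equality bracket for crux `MomentParity.ResolvedDissipation`
# (stmt-AnomalousDissipation-14284; line `lh-energy-equality-bracket`)

**Upper bracket.** `LHEE ⟹ ResolvedDissipation`: if every global Leray–Hopf weak solution of the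
Navier–Stokes equations on `T³` with a smooth, divergence-free, mean-zero steady force satisfies the
ENERGY EQUALITY between positive times (the Leray–Lions–Shinbrot energy-equality problem, open for
`d = 3`), then the mean enstrophy of bounded Galerkin-invariant ensembles is resolved by ONE schedule
uniformly in the truncation level (`ResolvedDissipation`, binder 2 of route MomentParity's `closes`).
Together with the disprover's lower bracket (`¬ResolvedDissipation` ⟺ kill shape ⟹ statistically
persistent blow-up, `Theorems/ResolvedDissipation/Negative/KillShape`, `Cruxes/…/WhyItResists.md`) this
pins the crux between two classical open problems of 3-D Navier–Stokes at fixed `ν`.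

Proof (Vishik–Fursikov lift of a leaking sequence; all five steps are landed files of this line):
`¬RD(f,ν,R)` ⟹ kill shape ⟹ (S1 `stub_leakingSequence`) levels `N_j → ∞` and admissible laws `μ_j`
whose mean resolved dissipation at every cutoff `K ≤ j` plus the margin `η = ν/(n+1)` is dominated by
the mean work ⟹ (landed `stub_levelLaw`, `stub_levelDissMean`, S2a `stub_levelWorkMean`) shift-invariant
level laws on the compact trajectory space `𝒦 = pathSpace R (pathLip ν A R)` with the same margin ⟹
(S2 `stub_limitLawDefect`) a shift-invariant limit law `Q` with the margin at every cutoff ⟹ (S3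
`stub_supportPointDefect`) a support path with a STRICT window-`[1,2]` energy inequality ⟹ (landed
`stub_supportApprox` + S4 `stub_realisedStrictInequality`) a global Leray–Hopf solution of NS(ν, f)
with a strict energy inequality between two positive times — contradicting LHEE(ν, f).

* `resolvedAt_of_lerayHopfEnergyEquality` — the bracket per force and viscosity: LHEE(ν, f) ⟹
  `RD(f, ν, R)` for every radius `R` (only `f` smooth and mean-zero are used).
* `resolvedDissipation_of_lerayHopfEnergyEquality` — the global form `LHEE ⟹ ResolvedDissipation`
  (hypothesis = the registered conjecture-grade stub `stub_lerayHopfEnergyEquality` verbatim).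
* `lerayHopfEnergyEquality_of_lionsClass` — LHEE HOLDS on the Lions–Shinbrot class `u ∈ L⁴L⁴`
  (tree `Torus.WeakNSEnergyClass.energy_eq_of_mem_Ioc`), certifying that the hypothesis is stated in
  exactly the currency the tree's energy-equality theorems conclude.

References: Leray 1934 §34; Lions 1960; Shinbrot 1974; Foias–Rosa–Temam 2013 (arXiv:1111.6257)
Thm. 3.1; Vishik–Fursikov 1988 Ch. IV; Foias–Manley–Rosa–Temam 2001 Ch. IV (1.31) and App. B;
Cheskidov–Friedlander–Shvydkoy arXiv:0704.0759; Berselli–Chiodaroli doi:10.1016/j.na.2019.111704.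
-/

noncomputable section

-- every `Summit.AnomalousDissipation.AnomalousDissipation.…` name repeats the summit = sub-problem segment (D-0017 layout)
set_option linter.dupNamespace false

namespace Summit.AnomalousDissipation.AnomalousDissipation.Theorems.MomentParityResolvedDissipation.LhBracket

open MeasureTheory Filter Topology Set Function Metric UnitAddTorus
open scoped ENNReal InnerProductSpace RealInnerProductSpace BigOperators
open Literature.Analysis.FunctionSpaces Literature.Analysis.FunctionSpaces.Torus
open Literature.Analysis.FluidPDE Literature.Analysis.FluidPDE.Torus
open Summit.AnomalousDissipation.AnomalousDissipation.Theses.MomentParity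
open Summit.AnomalousDissipation.AnomalousDissipation.Theorems.MomentParity
open Summit.AnomalousDissipation.AnomalousDissipation.Theorems.QuarticGate.Negative
  (IsLevel IsBandTest polyGrad IsPolyStationary)
open Summit.AnomalousDissipation.AnomalousDissipation.Theorems

/-! ### The bracket per force and viscosity -/

/-- **LHEE(ν, f) ⟹ ResolvedDissipation at (f, ν, R).** Fix `ν > 0` and a smooth mean-zero steady force
`f`. If every global Leray–Hopf weak solution of NS(ν, f) on `T³` (tree's sense `Torus.IsGlobalLerayHopf`)
satisfies the energy EQUALITY `½‖u(t₁)‖² + ν∫_{t₀}^{t₁}‖∇u‖² = ½‖u(t₀)‖² + ∫_{t₀}^{t₁}(f, u)` for all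
`0 < t₀ ≤ t₁`, then for every radius `R` ONE schedule `κ` resolves the mean enstrophy of every level-`N`
admissible law (probability, level-`N` carried, supported in `‖u‖ ≤ R`, stationary at all orders for
Galerkin NS) at every tolerance: `∫‖∇u‖² dμ ≤ ∫‖∇P_{κ n}u‖² dμ + 1/(n+1)`. Proof: the Vishik–Fursikov
lift of a leaking sequence described in the module docstring (S1, level laws + S2a, S2, S3,
`stub_supportApprox`, S4), ending in a global Leray–Hopf solution with a STRICT energy inequality between
two positive times. -/
theorem resolvedAt_of_lerayHopfEnergyEquality {ν : ℝ} (hν : 0 < ν)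
    {f : UnitAddTorus (Fin 3) → EuclideanSpace ℝ (Fin 3)} (hf : Torus.IsSmooth f) (hf0 : Torus.HasZeroMean f)
    (hLHEE : ∀ (u₀ : UnitAddTorus (Fin 3) → EuclideanSpace ℝ (Fin 3))
      (u : ℝ → UnitAddTorus (Fin 3) → EuclideanSpace ℝ (Fin 3)),
      Torus.IsGlobalLerayHopf ν (fun _ => f) u₀ u →
      ∀ (t₀ t₁ : ℝ), 0 < t₀ → t₀ ≤ t₁ →
        Torus.kineticEnergy (u t₁) + ν * (∫⁻ τ in Ioo t₀ t₁, Torus.eGradNormSq (u τ)).toReal =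
          Torus.kineticEnergy (u t₀) + ∫ τ in t₀..t₁, ∫ x, ⟪f x, u τ x⟫_ℝ)
    (R : ℝ) :
    ∃ κ : ℕ → ℕ, ∀ (N : ℕ) (μ : Measure (Torus.energySpace (Fin 3))), IsProbabilityMeasure μ →
      (∀ᵐ u ∂μ, IsLevel N u) → (∀ᵐ u ∂μ, ‖u‖ ≤ R) →
      ResolvedDissipation.Negative.IsStationary ν f N μ →
      ∀ n : ℕ, ResolvedDissipation.Negative.IsResolved κ μ n := by
  by_contra hRD
  -- the kill shape at `(f, ν, R)`: one tolerance `n` and, for every cutoff, an unresolved admissible law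
  have hkill : ∃ n : ℕ, ∀ K : ℕ, ∃ (N : ℕ) (μ : Measure (Torus.energySpace (Fin 3))),
      IsProbabilityMeasure μ ∧ (∀ᵐ u ∂μ, IsLevel N u) ∧ (∀ᵐ u ∂μ, ‖u‖ ≤ R) ∧
      ResolvedDissipation.Negative.IsStationary ν f N μ ∧
      ¬ ResolvedDissipation.Negative.IsResolved (fun _ => K) μ n := by
    by_contra hcon
    push Not at hcon
    choose Kf hKf using hcon
    exact hRD ⟨Kf, fun N μ hp hl hb hs n => hKf n N μ hp hl hb hs⟩
  obtain ⟨n, hK⟩ := hkill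
  -- S1: the leaking sequence
  obtain ⟨Ns, μs, hNs, hprob, hlev, hball, hstat, hdef⟩ :=
    LeakingSequence.stub_leakingSequence ν hν f hf R n hK
  haveI hprob' : ∀ j, IsProbabilityMeasure (μs j) := hprob
  -- the margin
  set η : ℝ := ν * ((n : ℝ) + 1)⁻¹ with hη
  have hηpos : 0 < η := by positivity
  -- the coefficient bound and the trajectory space
  set A : ℝ := ∫ x, ‖f x‖ with hA
  have hA0 : 0 ≤ A := integral_nonneg fun _ => norm_nonneg _
  have hAk : ∀ j k, ‖coeffExt (freqBall (Ns j)) (fourierRestrict (freqBall (Ns j)) f) k‖ ≤ A :=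
    fun j k => norm_coeffExt_fourierRestrict_le hf (Ns j) k
  set L : (Fin 3 → ℤ) → ℝ := pathLip ν A R with hL
  have hL0 : ∀ k, 0 ≤ L k := fun k => zero_le_one.trans (one_le_pathLip hA0 k)
  set ω₀ : ↥(pathSpace (d := Fin 3) R L) := ⟨0, zero_mem_pathSpace R hL0⟩ with hω₀
  -- the clauses of the level laws
  have h1 : ∀ j, ∀ᵐ u ∂(μs j), ∀ k ∉ (freqBall (Ns j)).erase (0 : Fin 3 → ℤ),
      mFourierCoeff (EuclideanSpace.complexify ∘
        (u.1 : UnitAddTorus (Fin 3) → EuclideanSpace ℝ (Fin 3))) k = 0 :=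
    fun j => (hlev j).mono fun u hu => hu
  have hpoly : ∀ j, ∀ d : ℕ, IsPolyStationary ν f (Ns j) d (μs j) :=
    fun j d m g P hg _ => hstat j m g P hg
  have h4 : ∀ j, ∀ Φ : CylindricalTest (Fin 3),
      (∀ i, ∀ k ∉ (freqBall (Ns j)).erase (0 : Fin 3 → ℤ),
        mFourierCoeff (EuclideanSpace.complexify ∘ (Φ.g i)) k = 0) →
        Integrable (fun u => nsGeneratorPairing ν f u (Φ.grad u)) (μs j) ∧
          ∫ u, nsGeneratorPairing ν f u (Φ.grad u) ∂(μs j) = 0 :=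
    fun j Φ hΦ => MomentParityResolvedDissipation.admissible_rows_cylindrical hf (hlev j) (hball j) (hpoly j) Φ hΦ
  -- the level laws on the trajectory space
  set P : ℕ → Measure ↥(pathSpace (d := Fin 3) R L) := fun j =>
    ((μs j).map fun u : Torus.energySpace (Fin 3) =>
        fourierRestrict (freqBall (Ns j)) (u.1 : UnitAddTorus (Fin 3) → EuclideanSpace ℝ (Fin 3))).map
      (orbitPathOn ν (fourierRestrict (freqBall (Ns j)) f) R L ω₀) with hPdef
  have hlaw := fun j => stub_levelLaw hν hf hf0 (hAk j) hA0 ω₀ (h1 j) (hball j) (h4 j)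
  have hPprob : ∀ j, IsProbabilityMeasure (P j) := fun j => (hlaw j).1
  have hθ : ∀ j, (P j).map (pathShiftOn R L (pathShift_mapsTo R L)) = P j := fun j => (hlaw j).2.1
  have hcar := fun j => (hlaw j).2.2
  -- the margin at every level, in trajectory-space form (landed `stub_levelDissMean` + S2a)
  have hmargin : ∀ j K : ℕ, K ≤ j →
      (∫ ω, dissMean ν K ω.1 ∂(P j)) + η ≤
        ∫ ω, (∫ t in (0 : ℝ)..1, ∑' k : Fin 3 → ℤ,
          (inner ℂ (mFourierCoeff (EuclideanSpace.complexify ∘ f) k) (pathExt ω.1 t k)).re) ∂(P j) := by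
    intro j K hKj
    rw [hPdef, stub_levelDissMean hν hf hf0 (hAk j) hA0 ω₀ (h1 j) (hball j) (h4 j) K,
      LevelWorkMean.stub_levelWorkMean ν hν f hf hf0 (Ns j) R A (hAk j) hA0 ω₀ (μs j) (hprob j) (h1 j)
        (hball j) (h4 j)]
    exact hdef j K hKj
  -- S2: the limit law with the margin
  obtain ⟨Q, hQprob, hQθ, hQmargin, hQsupp⟩ :=
    LimitLawDefect.stub_limitLawDefect f hf R L ν η P hPprob hθ hmargin
  -- S3: a support path with a strict window-[1,2] inequality
  obtain ⟨ω, hω, hstrictω⟩ :=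
    SupportPointDefect.stub_supportPointDefect f hf R L hL0 ν η hν.le hηpos Q hQprob hQθ hQmargin
  -- approximation of the support point by confined Galerkin orbits (landed)
  obtain ⟨φ, hφ, c, hc, hconf, hmem, hlim⟩ :=
    stub_supportApprox (g := fun j => fourierRestrict (freqBall (Ns j)) f) P hcar (hQsupp ω hω)
  -- S4: realisation with a strict energy inequality
  obtain ⟨u, t₀, t₁, hLH, ht₀, ht₀₁, hlt⟩ :=
    RealisedStrictInequality.stub_realisedStrictInequality ν hν f hf R A (fun i => Ns (φ i))
      (hNs.comp hφ.tendsto_atTop) c hc hconf hmem ω.1 ω.2 hlim hstrictω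
  -- LHEE(ν, f): but Leray–Hopf solutions conserve energy
  exact absurd (hLHEE (u 0) u hLH t₀ t₁ ht₀ ht₀₁) (ne_of_lt hlt)

/-! ### LHEE holds on the Lions–Shinbrot class -/

/-- **The hypothesis of the bracket HOLDS on the Lions–Shinbrot class (sorry-free special case).** If the global
Leray–Hopf solution has `u₀ ∈ L²` and `u ∈ L⁴((0,T); L⁴)` for every `T`, then it satisfies the energy equality
between positive times — by the landed `Torus.WeakNSEnergyClass.energy_eq_of_mem_Ioc` (Lions 1960 / Shinbrot 1974 /
Temam Ch. III Thm 3.2 in the tree's currency; steady smooth force). So a counterexample to LHEE must be a genuinely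
non-Lions Leray–Hopf solution with an energy defect at fixed `ν > 0` (Lions 1960; Shinbrot 1974; Temam 1984, Ch. III, Thm. 3.2). -/
theorem lerayHopfEnergyEquality_of_lionsClass :
    ∀ (ν : ℝ), 0 < ν → ∀ (f : UnitAddTorus (Fin 3) → EuclideanSpace ℝ (Fin 3)), Torus.IsSmooth f →
    ∀ (u₀ : UnitAddTorus (Fin 3) → EuclideanSpace ℝ (Fin 3))
      (u : ℝ → UnitAddTorus (Fin 3) → EuclideanSpace ℝ (Fin 3)),
      Torus.IsGlobalLerayHopf ν (fun _ => f) u₀ u → MemLp u₀ 2 volume →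
      (∀ T : ℝ, 0 < T → ∫⁻ s in Ioo 0 T, ∫⁻ x, ‖u s x‖ₑ ^ 4 < ⊤) →
    ∀ (t₀ t₁ : ℝ), 0 < t₀ → t₀ ≤ t₁ →
      Torus.kineticEnergy (u t₁) + ν * (∫⁻ τ in Ioo t₀ t₁, Torus.eGradNormSq (u τ)).toReal =
        Torus.kineticEnergy (u t₀) + ∫ τ in t₀..t₁, ∫ x, ⟪f x, u τ x⟫_ℝ := by
  intro ν _hν f hf u₀ u hLH hu₀ hL4 t₀ t₁ ht₀ ht₀₁
  have hT : 0 < t₁ := ht₀.trans_le ht₀₁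
  have h := hLH t₁ hT
  exact Torus.WeakNSEnergyClass.energy_eq_of_mem_Ioc (d := Fin 3) (by decide) (by decide) h.weak h.energy_bound
    h.memLp h.memL2Sobolev h.weak_continuous hu₀ (hL4 t₁ hT) (Literature.Analysis.FluidPDE.aestronglyMeasurable_stLift_const hf _)
    (memLqLp_one_two_of_steady (hf.memLp 2) t₁) ⟨ht₀, ht₀₁⟩ ⟨ht₀₁, le_rfl⟩

/-! ### The global bracket -/

/-- **LHEE ⟹ `ResolvedDissipation`** (the upper half of the bracket of the crux). The hypothesis is, verbatim,
the conjecture-grade stub `stub_lerayHopfEnergyEquality` of the line: every global Leray–Hopf weak solution of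
NS with a smooth divergence-free mean-zero steady force on `T³` satisfies the energy equality between positive
times (Leray 1934 §34 / Lions 1960 / Shinbrot 1974; OPEN for `d = 3`, known on the Lions class `L⁴L⁴` — see
`lerayHopfEnergyEquality_of_lionsClass` — and on `L³B^{1/3}_{3,c₀}`, arXiv:0704.0759). Immediate from
`resolvedAt_of_lerayHopfEnergyEquality` (`ResolvedDissipation` unfolds to its clauses by `Iff.rfl`,
`ResolvedDissipation.Negative.resolvedDissipation_iff`). -/
theorem resolvedDissipation_of_lerayHopfEnergyEquality :
    (∀ (ν : ℝ), 0 < ν → ∀ (f : UnitAddTorus (Fin 3) → EuclideanSpace ℝ (Fin 3)),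
      Torus.IsSmooth f → Torus.IsDivFree f → Torus.HasZeroMean f →
    ∀ (u₀ : UnitAddTorus (Fin 3) → EuclideanSpace ℝ (Fin 3))
      (u : ℝ → UnitAddTorus (Fin 3) → EuclideanSpace ℝ (Fin 3)),
      Torus.IsGlobalLerayHopf ν (fun _ => f) u₀ u →
    ∀ (t₀ t₁ : ℝ), 0 < t₀ → t₀ ≤ t₁ →
      Torus.kineticEnergy (u t₁) + ν * (∫⁻ τ in Ioo t₀ t₁, Torus.eGradNormSq (u τ)).toReal =
        Torus.kineticEnergy (u t₀) + ∫ τ in t₀..t₁, ∫ x, ⟪f x, u τ x⟫_ℝ) →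
    ResolvedDissipation := by
  intro hLHEE
  rw [ResolvedDissipation.Negative.resolvedDissipation_iff]
  intro f hf hdiv hf0 ν hν R
  exact resolvedAt_of_lerayHopfEnergyEquality hν hf hf0 (hLHEE ν hν f hf hdiv hf0) R

end Summit.AnomalousDissipation.AnomalousDissipation.Theorems.MomentParityResolvedDissipation.LhBracket

end
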